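import Summits.NavierStokesRegularity.NavierStokesRegularity.Theorems.AdaptedFrequencyAdaptedKernelExistsWeakCorrectorCalculus
import Summits.NavierStokesRegularity.NavierStokesRegularity.Theorems.AdaptedFrequencyAdaptedKernelExistsLowerOfUpperBridge
import Literature.Analysis.FluidPDE.WholeSpaceIBP
import Literature.Analysis.FluidPDE.NewtonPotential
import Literature.Analysis.UnboundedOperators.HeatKernelGradient
import Mathlib.MeasureTheory.Integral.IntervalIntegral.IntegrationByParts

/-!
# Crux `AdaptedKernelExists` (stmt-NavierStokesRegularity-2956), line `nash-entropy-last-block`: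
  the backward heat kernel `Γ` against test functions for STUB `stub_weakCorrector`

Helper file (lands `--supports stmt-NavierStokesRegularity-2956`) for the registered stub
`stub_weakCorrector`.  With `Γ(t, x) = backwardHeatKernel ν T x₀ t x` (smooth on `t < T`,
`∂ₜΓ + νΔΓ = 0`) and a `C¹` drift `b` with divergence-free slices:

* `weakCorrector_norm_fderiv_gamma_le`, `weakCorrector_memLp_source`: the source
  `F = b·∇Γ` of the corrector equation, weighted by `e^{t}`, lies in `L²((ta, Ta) × ℝ³)` for
  `Ta < T` and bounded `b` (Gaussian gradient bound `norm_fderiv_heatKernel_le`);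
* `weakCorrector_gamma_ibp` (registered sub-goal `stub_weakCorrector_gamma`): for every smooth
  `φ` compactly supported in `{t < T}`,
  `∫ Γ (∂ₜφ + b·∇φ − νΔφ) = −∫ (b·∇Γ) φ`
  (integration by parts in `t` line by line, the transport identity and Green's second identity
  slice by slice, Fubini; the `∂ₜ` and `Δ` contributions cancel by `∂ₜΓ = −νΔΓ`).
-/

noncomputable section

open MeasureTheory Set Filter Topology Metric Function intervalIntegral
open scoped ContDiff Laplacian InnerProductSpace

namespace Summit.NavierStokesRegularity.NavierStokesRegularity.Theorems.AdaptedKernelExists.NashEntropyLastBlock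

open Literature.Analysis.FluidPDE Literature.Analysis.UnboundedOperators


section Gamma

variable {ν T ta Ta : ℝ} {x₀ : (EuclideanSpace ℝ (Fin 3))} {b : ℝ → (EuclideanSpace ℝ (Fin 3)) →
    (EuclideanSpace ℝ (Fin 3))} {φ : ℝ × (EuclideanSpace ℝ (Fin 3)) → ℝ}

/-- Every time slice of the backward heat kernel is smooth (also at the junk times `t ≥ T`). -/
theorem weakCorrector_contDiff_gamma_slice {n : WithTop ℕ∞} (ν T : ℝ) (x₀ : (EuclideanSpace ℝ (Fin
    3))) (t : ℝ) :
    ContDiff ℝ n (backwardHeatKernel ν T x₀ t) :=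
  (Scheffer.contDiff_heatKernel (ν * (T - t))).comp (contDiff_id.sub contDiff_const)

/-- The gradient of a slice of the backward heat kernel is the gradient of the heat kernel at
the translated point. -/
theorem weakCorrector_fderiv_gamma_eq (ν T : ℝ) (x₀ : (EuclideanSpace ℝ (Fin 3))) (t : ℝ) (x :
    (EuclideanSpace ℝ (Fin 3))) :
    fderiv ℝ (backwardHeatKernel ν T x₀ t) x = fderiv ℝ (heatKernel (ν * (T - t))) (x - x₀) := by
  have hd : HasFDerivAt (heatKernel (E := (EuclideanSpace ℝ (Fin 3))) (ν * (T - t)))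
      (fderiv ℝ (heatKernel (ν * (T - t))) (x - x₀)) (x - x₀) :=
    (hasFDerivAt_heatKernel (ν * (T - t)) (x - x₀)).differentiableAt.hasFDerivAt
  have h1 : HasFDerivAt (backwardHeatKernel ν T x₀ t)
      ((fderiv ℝ (heatKernel (ν * (T - t))) (x - x₀)).comp (ContinuousLinearMap.id ℝ
          (EuclideanSpace ℝ (Fin 3)))) x :=
    hd.comp x ((hasFDerivAt_id x).sub_const x₀)
  rw [h1.fderiv, ContinuousLinearMap.comp_id]

/-- **Gaussian gradient bound on a closed time strip**: for `t ∈ [ta, Ta]`, `Ta < T`,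
`‖∇Γ(t, x)‖ ≤ (4πν(T−Ta))^{-3/2} (ν(T−Ta))^{-1/2} e^{−‖x−x₀‖²/(8ν(T−ta))}`. -/
theorem weakCorrector_norm_fderiv_gamma_le (hν : 0 < ν) (hTa : Ta < T) {t : ℝ} (ht : t ∈ Icc ta Ta)
    (x : (EuclideanSpace ℝ (Fin 3))) :
    ‖fderiv ℝ (backwardHeatKernel ν T x₀ t) x‖ ≤
      (4 * Real.pi * (ν * (T - Ta))) ^ (-(3 : ℝ) / 2) * (Real.sqrt (ν * (T - Ta)))⁻¹ *
        Real.exp (-(1 / (8 * (ν * (T - ta)))) * ‖x - x₀‖ ^ 2) := by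
  have hσ0 : 0 < ν * (T - Ta) := mul_pos hν (sub_pos.2 hTa)
  have hσ : ν * (T - Ta) ≤ ν * (T - t) := mul_le_mul_of_nonneg_left (by linarith [ht.2]) hν.le
  have hσpos : 0 < ν * (T - t) := hσ0.trans_le hσ
  have hσ1 : ν * (T - t) ≤ ν * (T - ta) := mul_le_mul_of_nonneg_left (by linarith [ht.1]) hν.le
  have key := norm_fderiv_heatKernel_le hσpos (x - x₀)
  simp only [finrank_euclideanSpace_fin, Nat.cast_ofNat] at key
  rw [weakCorrector_fderiv_gamma_eq]
  refine key.trans ?_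
  have e1 : (4 * Real.pi * (ν * (T - t))) ^ (-(3 : ℝ) / 2) ≤
      (4 * Real.pi * (ν * (T - Ta))) ^ (-(3 : ℝ) / 2) :=
    Real.rpow_le_rpow_of_nonpos (by positivity)
      (mul_le_mul_of_nonneg_left hσ (by positivity)) (by norm_num)
  have e2 : (Real.sqrt (ν * (T - t)))⁻¹ ≤ (Real.sqrt (ν * (T - Ta)))⁻¹ :=
    inv_anti₀ (Real.sqrt_pos.2 hσ0) (Real.sqrt_le_sqrt hσ)
  have e3 : Real.exp (-(1 / (8 * (ν * (T - t)))) * ‖x - x₀‖ ^ 2) ≤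
      Real.exp (-(1 / (8 * (ν * (T - ta)))) * ‖x - x₀‖ ^ 2) := by
    refine Real.exp_le_exp.2 ?_
    rw [neg_mul, neg_mul, neg_le_neg_iff]
    refine mul_le_mul_of_nonneg_right ?_ (sq_nonneg _)
    exact one_div_le_one_div_of_le (by positivity) (by linarith)
  exact mul_le_mul (mul_le_mul e1 e2 (by positivity) (by positivity)) e3 (by positivity)
    (by positivity)

/-- **The weighted source is square integrable on the strip**: for `ta < Ta < T`, a jointly
continuous drift with `‖b‖ ≤ B`, the function `(t, x) ↦ (b·∇Γ)(t, x) e^{t}` lies in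
`L²((ta, Ta) × ℝ³)`. -/
theorem weakCorrector_memLp_source (hν : 0 < ν) (hta : ta < Ta) (hTa : Ta < T) {B : ℝ}
    (hb : Continuous (uncurry b)) (hB : ∀ t x, ‖b t x‖ ≤ B) :
    MemLp (fun p : ℝ × (EuclideanSpace ℝ (Fin 3)) =>
        fderiv ℝ (backwardHeatKernel ν T x₀ p.1) p.2 (b p.1 p.2) * Real.exp p.1) 2
      (volume.restrict (Ioo ta Ta ×ˢ univ)) := by
  set S : Set (ℝ × (EuclideanSpace ℝ (Fin 3))) := Ioo ta Ta ×ˢ univ with hS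
  have hSm : MeasurableSet S := measurableSet_Ioo.prod MeasurableSet.univ
  have hSU : S ⊆ Iio T ×ˢ univ := prod_mono (fun t ht => lt_trans ht.2 hTa) Subset.rfl
  set μt : Measure ℝ := volume.restrict (Ioo ta Ta) with hμt
  haveI : IsFiniteMeasure μt := ⟨by
    rw [hμt, Measure.restrict_apply_univ]; exact measure_Ioo_lt_top⟩
  have hπ : (volume : Measure (ℝ × (EuclideanSpace ℝ (Fin 3)))).restrict S = μt.prod volume := by
    rw [hμt, show (volume : Measure (ℝ × (EuclideanSpace ℝ (Fin 3)))) = (volume : Measure ℝ).prod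
        (volume : Measure (EuclideanSpace ℝ (Fin 3)))
      from rfl, hS, ← Measure.prod_restrict, Measure.restrict_univ]
  have hB0 : 0 ≤ B := (norm_nonneg _).trans (hB ta x₀)
  -- continuity on the strip
  have hcD : ContinuousOn (fun p : ℝ × (EuclideanSpace ℝ (Fin 3)) => fderiv ℝ (backwardHeatKernel ν
      T x₀ p.1) p.2) S :=
    (lowerOfUpper_continuousOn_fderiv_slice isOpen_Iio
      (contDiffOn_uncurry_backwardHeatKernel hν T x₀ (m := 2))).mono hSU
  have hcF : ContinuousOn (fun p : ℝ × (EuclideanSpace ℝ (Fin 3)) =>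
      fderiv ℝ (backwardHeatKernel ν T x₀ p.1) p.2 (b p.1 p.2) * Real.exp p.1) S :=
    (hcD.clm_apply hb.continuousOn).mul (Real.continuous_exp.comp continuous_fst).continuousOn
  rw [memLp_two_iff_integrable_sq (hcF.aestronglyMeasurable hSm)]
  -- the Gaussian majorant
  set K₀ : ℝ := (4 * Real.pi * (ν * (T - Ta))) ^ (-(3 : ℝ) / 2) * (Real.sqrt (ν * (T - Ta)))⁻¹
    with hK₀
  set c : ℝ := 1 / (8 * (ν * (T - ta))) with hc
  have hTta : 0 < T - ta := by linarith
  have hc0 : 0 < c := by rw [hc]; positivity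
  have hK₀0 : 0 ≤ K₀ := by rw [hK₀]; positivity
  set M : ℝ := K₀ * B * Real.exp Ta with hM
  have hg : Integrable (fun p : ℝ × (EuclideanSpace ℝ (Fin 3)) => M ^ 2 * Real.exp (-(2 * c) * ‖p.2
      - x₀‖ ^ 2))
      ((volume : Measure (ℝ × (EuclideanSpace ℝ (Fin 3)))).restrict S) := by
    rw [hπ]
    exact (integrable_const (M ^ 2)).mul_prod
      ((integrable_gaussian_of_pos (mul_pos two_pos hc0)).comp_sub_right x₀)
  refine hg.mono' ((hcF.pow 2).aestronglyMeasurable hSm) ?_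
  rw [ae_restrict_iff' hSm]
  refine Eventually.of_forall fun p hp => ?_
  obtain ⟨t, x⟩ := p
  have ht : t ∈ Icc ta Ta := Ioo_subset_Icc_self hp.1
  have h1 : |fderiv ℝ (backwardHeatKernel ν T x₀ t) x (b t x) * Real.exp t| ≤
      M * Real.exp (-c * ‖x - x₀‖ ^ 2) := by
    rw [abs_mul, abs_of_pos (Real.exp_pos t), hM]
    have h2 : |fderiv ℝ (backwardHeatKernel ν T x₀ t) x (b t x)| ≤
        K₀ * Real.exp (-c * ‖x - x₀‖ ^ 2) * B := by
      rw [← Real.norm_eq_abs]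
      refine (ContinuousLinearMap.le_opNorm _ _).trans ?_
      exact mul_le_mul (weakCorrector_norm_fderiv_gamma_le hν hTa ht x) (hB t x) (norm_nonneg _)
        (by positivity)
    have h3 : Real.exp t ≤ Real.exp Ta := Real.exp_le_exp.2 ht.2
    calc |fderiv ℝ (backwardHeatKernel ν T x₀ t) x (b t x)| * Real.exp t
        ≤ K₀ * Real.exp (-c * ‖x - x₀‖ ^ 2) * B * Real.exp Ta :=
          mul_le_mul h2 h3 (Real.exp_pos t).le (by positivity)
      _ = K₀ * B * Real.exp Ta * Real.exp (-c * ‖x - x₀‖ ^ 2) := by ring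
  have hM0 : 0 ≤ M := by rw [hM]; positivity
  have h4 : (fderiv ℝ (backwardHeatKernel ν T x₀ t) x (b t x) * Real.exp t) ^ 2 ≤
      (M * Real.exp (-c * ‖x - x₀‖ ^ 2)) ^ 2 := by
    rw [← sq_abs]
    exact pow_le_pow_left₀ (abs_nonneg _) h1 2
  have h5 : (M * Real.exp (-c * ‖x - x₀‖ ^ 2)) ^ 2 = M ^ 2 * Real.exp (-(2 * c) * ‖x - x₀‖ ^ 2) :=
      by
    rw [mul_pow, ← Real.exp_nat_mul]
    congr 2
    push_cast
    ring
  rw [Real.norm_eq_abs, abs_of_nonneg (sq_nonneg _)]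
  exact h4.trans_eq h5

/-! #### Slice identities for `Γ` -/

/-- Transport slice identity: `∫ Γ(t) (b(t)·∇φ(t)) dx = −∫ (b(t)·∇Γ(t)) φ(t) dx`. -/
theorem weakCorrector_gamma_slice_transport {t : ℝ} (hb : ContDiff ℝ 1 (b t))
    (hdiv : VectorCalculus.IsDivFree (b t)) (hφ : ContDiff ℝ 1 fun y : (EuclideanSpace ℝ (Fin 3))
        => φ (t, y))
    (hφc : HasCompactSupport fun y : (EuclideanSpace ℝ (Fin 3)) => φ (t, y)) :
    ∫ x, backwardHeatKernel ν T x₀ t x * fderiv ℝ (fun y => φ (t, y)) x (b t x) =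
      -∫ x, fderiv ℝ (backwardHeatKernel ν T x₀ t) x (b t x) * φ (t, x) := by
  have hΓ : ContDiff ℝ 1 (backwardHeatKernel ν T x₀ t) := weakCorrector_contDiff_gamma_slice ν T x₀
      t
  have h := integral_inner_convect_add_eq_zero hb hΓ hφ hφc
  have h0 : (fun x => VectorCalculus.divergence (b t) x *
      ⟪backwardHeatKernel ν T x₀ t x, (fun y : (EuclideanSpace ℝ (Fin 3)) => φ (t, y)) x⟫_ℝ) = fun
          _ => 0 := by
    funext x; rw [hdiv x, zero_mul]
  rw [h0, MeasureTheory.integral_zero, add_zero] at h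
  simp only [convect_apply, RCLike.inner_apply, conj_trivial] at h
  have e1 : ∫ x, (fderiv ℝ (fun y => φ (t, y)) x) (b t x) * backwardHeatKernel ν T x₀ t x =
      ∫ x, backwardHeatKernel ν T x₀ t x * (fderiv ℝ (fun y => φ (t, y)) x) (b t x) :=
    integral_congr_ae (Eventually.of_forall fun x => mul_comm _ _)
  have e2 : ∫ x, φ (t, x) * (fderiv ℝ (backwardHeatKernel ν T x₀ t) x) (b t x) =
      ∫ x, (fderiv ℝ (backwardHeatKernel ν T x₀ t) x) (b t x) * φ (t, x) :=
    integral_congr_ae (Eventually.of_forall fun x => mul_comm _ _)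
  linarith

/-- Green slice identity: `∫ Γ(t) Δφ(t) dx = ∫ ΔΓ(t) φ(t) dx`. -/
theorem weakCorrector_gamma_slice_laplacian {t : ℝ} (hφ : ContDiff ℝ 2 fun y : (EuclideanSpace ℝ
    (Fin 3)) => φ (t, y))
    (hφc : HasCompactSupport fun y : (EuclideanSpace ℝ (Fin 3)) => φ (t, y)) :
    ∫ x, backwardHeatKernel ν T x₀ t x * (Δ (fun y => φ (t, y))) x =
      ∫ x, (Δ (backwardHeatKernel ν T x₀ t)) x * φ (t, x) := by
  have h := integral_mul_laplacian_comm (f := backwardHeatKernel ν T x₀ t) (g := fun y => φ (t, y))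
    (weakCorrector_contDiff_gamma_slice ν T x₀ t) hφ hφc
  calc ∫ x, backwardHeatKernel ν T x₀ t x * (Δ (fun y => φ (t, y))) x
      = ∫ x, (Δ (fun y => φ (t, y))) x * backwardHeatKernel ν T x₀ t x :=
        integral_congr_ae (Eventually.of_forall fun x => mul_comm _ _)
    _ = ∫ x, φ (t, x) * (Δ (backwardHeatKernel ν T x₀ t)) x := h.symm
    _ = ∫ x, (Δ (backwardHeatKernel ν T x₀ t)) x * φ (t, x) :=
        integral_congr_ae (Eventually.of_forall fun x => mul_comm _ _)

/-- Integration by parts along a time line: for `a < c < T` and a `C¹` function `φ` whose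
support has time projection inside `(a, c)`,
`∫ Γ(t, x) ∂ₜφ(t, x) dt = ν ∫ ΔΓ(t, x) φ(t, x) dt` (`∂ₜΓ = −νΔΓ` on `t < T`). -/
theorem weakCorrector_gamma_line_ibp (hν : 0 < ν) {a c : ℝ} (hac : a < c) (hcT : c < T)
    (hφ : ContDiff ℝ 1 φ) (hsupp : ∀ p ∈ tsupport φ, p.1 ∈ Ioo a c) (x : (EuclideanSpace ℝ (Fin
        3))) :
    ∫ t, backwardHeatKernel ν T x₀ t x * deriv (fun s => φ (s, x)) t =
      ∫ t, ν * (Δ (backwardHeatKernel ν T x₀ t)) x * φ (t, x) := by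
  have hs1 : support (fun t => backwardHeatKernel ν T x₀ t x * deriv (fun s => φ (s, x)) t) ⊆
      Ioc a c := by
    intro t ht
    have h' : deriv (fun s => φ (s, x)) t ≠ 0 := fun h0 => ht (by simp only [h0, mul_zero])
    have hmem : (t, x) ∈ tsupport φ :=
      by_contra fun hn => h' (weakCorrector_deriv_slice_eq_zero hφ (p := (t, x)) hn)
    exact Ioo_subset_Ioc_self (hsupp _ hmem)
  have hs2 : support (fun t => ν * (Δ (backwardHeatKernel ν T x₀ t)) x * φ (t, x)) ⊆ Ioc a c := by
    intro t ht
    have h' : φ (t, x) ≠ 0 := fun h0 => ht (by simp only [h0, mul_zero])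
    exact Ioo_subset_Ioc_self (hsupp _ (subset_tsupport _ h'))
  rw [← intervalIntegral.integral_eq_integral_of_support_subset hs1,
    ← intervalIntegral.integral_eq_integral_of_support_subset hs2]
  have hu : ∀ t ∈ uIcc a c, HasDerivAt (fun s => backwardHeatKernel ν T x₀ s x)
      (-(ν * (Δ (backwardHeatKernel ν T x₀ t)) x)) t := by
    intro t ht
    rw [uIcc_of_le hac.le] at ht
    exact (hasDerivAt_backwardHeatKernel hν x₀ (ht.2.trans_lt hcT) x).congr_deriv
      (by rw [laplacian_backwardHeatKernel])
  have hv : ∀ t ∈ uIcc a c, HasDerivAt (fun s => φ (s, x)) (deriv (fun s => φ (s, x)) t) t :=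
    fun t _ => ((weakCorrector_contDiff_slice_t hφ x).differentiable one_ne_zero t).hasDerivAt
  have hL := lowerOfUpper_continuousOn_laplacian_slice isOpen_Iio
    (contDiffOn_uncurry_backwardHeatKernel hν T x₀ (m := 2))
  have hm : MapsTo (fun t : ℝ => ((t, x) : ℝ × (EuclideanSpace ℝ (Fin 3)))) (Iio T) (Iio T ×ˢ univ)
      :=
    fun t ht => mk_mem_prod ht (mem_univ x)
  have hpc : Continuous (fun t : ℝ => ((t, x) : ℝ × (EuclideanSpace ℝ (Fin 3)))) :=
      continuous_id.prodMk continuous_const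
  have hLx : ContinuousOn (fun t : ℝ => (Δ (backwardHeatKernel ν T x₀ t)) x) (Iio T) :=
    (hL.comp hpc.continuousOn hm :)
  have hIcc : Icc a c ⊆ Iio T := fun t ht => ht.2.trans_lt hcT
  have hu' : IntervalIntegrable (fun t => -(ν * (Δ (backwardHeatKernel ν T x₀ t)) x)) volume a c :=
    ((continuousOn_const.mul hLx).neg.mono hIcc).intervalIntegrable_of_Icc hac.le
  have hv' : IntervalIntegrable (fun t => deriv (fun s => φ (s, x)) t) volume a c :=
    ((weakCorrector_continuous_deriv_slice hφ).comp
      (continuous_id.prodMk continuous_const)).intervalIntegrable _ _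
  rw [intervalIntegral.integral_mul_deriv_eq_deriv_mul hu hv hu' hv']
  have hφc0 : φ (c, x) = 0 :=
    by_contra fun h => (lt_irrefl c) (hsupp _ (subset_tsupport _ h)).2
  have hφa0 : φ (a, x) = 0 :=
    by_contra fun h => (lt_irrefl a) (hsupp _ (subset_tsupport _ h)).1
  rw [hφc0, hφa0, mul_zero, mul_zero, sub_zero, zero_sub, ← intervalIntegral.integral_neg]
  exact intervalIntegral.integral_congr fun t _ => by ring

/-- **`Γ` against test functions** (very weak form of `∂ₜΓ + b·∇Γ + νΔΓ = b·∇Γ`): for a `C¹`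
drift with divergence-free slices and a smooth `φ` compactly supported in `{t < T}`,
`∫ Γ (∂ₜφ + b·∇φ − νΔφ) = −∫ (b·∇Γ) φ`. -/
theorem weakCorrector_gamma_ibp (hν : 0 < ν) (hb : ContDiff ℝ 1 (uncurry b))
    (hdiv : ∀ t, VectorCalculus.IsDivFree (b t)) (hφ : ContDiff ℝ ∞ φ) (hφc : HasCompactSupport φ)
    (hφT : tsupport φ ⊆ Iio T ×ˢ univ) :
    ∫ p : ℝ × (EuclideanSpace ℝ (Fin 3)), backwardHeatKernel ν T x₀ p.1 p.2 * (deriv (fun s => φ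
        (s, p.2)) p.1 +
        fderiv ℝ (fun y => φ (p.1, y)) p.2 (b p.1 p.2) - ν * (Δ (fun y => φ (p.1, y))) p.2) =
      -∫ p : ℝ × (EuclideanSpace ℝ (Fin 3)), fderiv ℝ (backwardHeatKernel ν T x₀ p.1) p.2 (b p.1
          p.2) * φ p := by
  set U : Set (ℝ × (EuclideanSpace ℝ (Fin 3))) := Iio T ×ˢ univ with hU
  have hUo : IsOpen U := isOpen_Iio.prod isOpen_univ
  have hΓc : ContDiffOn ℝ 2 (uncurry (backwardHeatKernel ν T x₀)) U :=
    contDiffOn_uncurry_backwardHeatKernel hν T x₀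
  have cΓ : ContinuousOn (fun p : ℝ × (EuclideanSpace ℝ (Fin 3)) => backwardHeatKernel ν T x₀ p.1
      p.2) U := hΓc.continuousOn
  have cD : ContinuousOn (fun p : ℝ × (EuclideanSpace ℝ (Fin 3)) => fderiv ℝ (backwardHeatKernel ν
      T x₀ p.1) p.2) U :=
    lowerOfUpper_continuousOn_fderiv_slice isOpen_Iio hΓc
  have cL : ContinuousOn (fun p : ℝ × (EuclideanSpace ℝ (Fin 3)) => (Δ (backwardHeatKernel ν T x₀
      p.1)) p.2) U :=
    lowerOfUpper_continuousOn_laplacian_slice isOpen_Iio hΓc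
  have hφ1 := weakCorrector_contDiff_one_of_infty hφ
  have hφ2 := weakCorrector_contDiff_two_of_infty hφ
  have hbc : Continuous (uncurry b) := hb.continuous
  -- the slice fields of `φ`
  obtain ⟨A, hA⟩ : ∃ A : ℝ × (EuclideanSpace ℝ (Fin 3)) → ℝ, A = fun p => deriv (fun s => φ (s,
      p.2)) p.1 := ⟨_, rfl⟩
  obtain ⟨Bf, hBf⟩ : ∃ Bf : ℝ × (EuclideanSpace ℝ (Fin 3)) → ℝ,
      Bf = fun p => fderiv ℝ (fun y => φ (p.1, y)) p.2 (b p.1 p.2) := ⟨_, rfl⟩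
  obtain ⟨L, hL⟩ : ∃ L : ℝ × (EuclideanSpace ℝ (Fin 3)) → ℝ, L = fun p => (Δ (fun y => φ (p.1, y)))
      p.2 := ⟨_, rfl⟩
  have cA : Continuous A := hA ▸ weakCorrector_continuous_deriv_slice hφ1
  have cB : Continuous Bf := hBf ▸ weakCorrector_continuous_fderiv_slice hφ1 hbc
  have cLφ : Continuous L := hL ▸ weakCorrector_continuous_laplacian_slice hφ
  have zA : ∀ p, p ∉ tsupport φ → A p = 0 := fun p hp => by
    rw [hA]; exact weakCorrector_deriv_slice_eq_zero hφ1 hp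
  have zB : ∀ p, p ∉ tsupport φ → Bf p = 0 := fun p hp => by
    rw [hBf]; exact weakCorrector_fderiv_slice_eq_zero hφ1 hp _
  have zL : ∀ p, p ∉ tsupport φ → L p = 0 := fun p hp => by
    rw [hL]; exact weakCorrector_laplacian_slice_eq_zero hφ2 hp
  have zφ : ∀ p, p ∉ tsupport φ → φ p = 0 := fun p hp => image_eq_zero_of_notMem_tsupport hp
  -- integrability: continuous (gluing) with compact support
  have hint : ∀ {g f : ℝ × (EuclideanSpace ℝ (Fin 3)) → ℝ}, ContinuousOn g U → Continuous f →
      (∀ p, p ∉ tsupport φ → f p = 0) → Integrable (fun p => g p * f p) :=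
    fun hg hf hf0 => weakCorrector_integrable_mul_of_tsupport hUo hg hf hφc hφT hf0
  have iA := hint cΓ cA zA
  have iB := hint cΓ cB zB
  have iL := hint cΓ cLφ zL
  have iF := hint (cD.clm_apply hbc.continuousOn) hφ.continuous zφ
  have cνL : ContinuousOn (fun p : ℝ × (EuclideanSpace ℝ (Fin 3)) => ν * (Δ (backwardHeatKernel ν T
      x₀ p.1)) p.2) U :=
    continuousOn_const.mul cL
  have iLΓ := hint cνL hφ.continuous zφ
  have iLΓ' := hint cL hφ.continuous zφ
  -- (B1) the time term
  have h1 : ∫ p : ℝ × (EuclideanSpace ℝ (Fin 3)), backwardHeatKernel ν T x₀ p.1 p.2 * A p =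
      ∫ p : ℝ × (EuclideanSpace ℝ (Fin 3)), ν * (Δ (backwardHeatKernel ν T x₀ p.1)) p.2 * φ p := by
    obtain ⟨a, c, hac, hcT, hsupp⟩ := weakCorrector_time_bounds hφc hφT
    have e1 : ∫ p : ℝ × (EuclideanSpace ℝ (Fin 3)), backwardHeatKernel ν T x₀ p.1 p.2 * A p =
        ∫ x, ∫ t, backwardHeatKernel ν T x₀ t x * A (t, x) := integral_prod_symm _ iA
    have e2 : ∫ p : ℝ × (EuclideanSpace ℝ (Fin 3)), ν * (Δ (backwardHeatKernel ν T x₀ p.1)) p.2 * φ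
        p =
        ∫ x, ∫ t, ν * (Δ (backwardHeatKernel ν T x₀ t)) x * φ (t, x) := integral_prod_symm _ iLΓ
    rw [e1, e2]
    refine integral_congr_ae (Eventually.of_forall fun x => ?_)
    simp only [hA]
    exact weakCorrector_gamma_line_ibp hν hac hcT hφ1 hsupp x
  -- (B2) the transport term
  have h2 : ∫ p : ℝ × (EuclideanSpace ℝ (Fin 3)), backwardHeatKernel ν T x₀ p.1 p.2 * Bf p =
      -∫ p : ℝ × (EuclideanSpace ℝ (Fin 3)), fderiv ℝ (backwardHeatKernel ν T x₀ p.1) p.2 (b p.1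
          p.2) * φ p := by
    have e1 : ∫ p : ℝ × (EuclideanSpace ℝ (Fin 3)), backwardHeatKernel ν T x₀ p.1 p.2 * Bf p =
        ∫ t, ∫ x, backwardHeatKernel ν T x₀ t x * Bf (t, x) := integral_prod _ iB
    have e2 : ∫ p : ℝ × (EuclideanSpace ℝ (Fin 3)), fderiv ℝ (backwardHeatKernel ν T x₀ p.1) p.2 (b
        p.1 p.2) * φ p =
        ∫ t, ∫ x, fderiv ℝ (backwardHeatKernel ν T x₀ t) x (b t x) * φ (t, x) :=
      integral_prod _ iF
    rw [e1, e2, ← MeasureTheory.integral_neg]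
    refine integral_congr_ae (Eventually.of_forall fun t => ?_)
    simp only [hBf]
    exact weakCorrector_gamma_slice_transport (hb.comp (contDiff_const.prodMk contDiff_id)) (hdiv t)
      (weakCorrector_contDiff_slice_x hφ1 t) (weakCorrector_hasCompactSupport_slice hφc t)
  -- (B3) the viscous term
  have h3 : ∫ p : ℝ × (EuclideanSpace ℝ (Fin 3)), backwardHeatKernel ν T x₀ p.1 p.2 * L p =
      ∫ p : ℝ × (EuclideanSpace ℝ (Fin 3)), (Δ (backwardHeatKernel ν T x₀ p.1)) p.2 * φ p := by
    have e1 : ∫ p : ℝ × (EuclideanSpace ℝ (Fin 3)), backwardHeatKernel ν T x₀ p.1 p.2 * L p =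
        ∫ t, ∫ x, backwardHeatKernel ν T x₀ t x * L (t, x) := integral_prod _ iL
    have e2 : ∫ p : ℝ × (EuclideanSpace ℝ (Fin 3)), (Δ (backwardHeatKernel ν T x₀ p.1)) p.2 * φ p =
        ∫ t, ∫ x, (Δ (backwardHeatKernel ν T x₀ t)) x * φ (t, x) := integral_prod _ iLΓ'
    rw [e1, e2]
    refine integral_congr_ae (Eventually.of_forall fun t => ?_)
    simp only [hL]
    exact weakCorrector_gamma_slice_laplacian (weakCorrector_contDiff_slice_x hφ2 t)
      (weakCorrector_hasCompactSupport_slice hφc t)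
  -- assemble
  have hdec : ∀ p : ℝ × (EuclideanSpace ℝ (Fin 3)), backwardHeatKernel ν T x₀ p.1 p.2 * (deriv (fun
      s => φ (s, p.2)) p.1 +
      fderiv ℝ (fun y => φ (p.1, y)) p.2 (b p.1 p.2) - ν * (Δ (fun y => φ (p.1, y))) p.2) =
      backwardHeatKernel ν T x₀ p.1 p.2 * A p + backwardHeatKernel ν T x₀ p.1 p.2 * Bf p -
        ν * (backwardHeatKernel ν T x₀ p.1 p.2 * L p) := by
    intro p; rw [hA, hBf, hL]; ring
  simp_rw [hdec]
  have i12 : Integrable (fun p : ℝ × (EuclideanSpace ℝ (Fin 3)) => backwardHeatKernel ν T x₀ p.1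
      p.2 * A p +
      backwardHeatKernel ν T x₀ p.1 p.2 * Bf p) := iA.add iB
  have i3 : Integrable (fun p : ℝ × (EuclideanSpace ℝ (Fin 3)) => ν * (backwardHeatKernel ν T x₀
      p.1 p.2 * L p)) :=
    iL.const_mul ν
  have h1' : ∫ p : ℝ × (EuclideanSpace ℝ (Fin 3)), ν * (Δ (backwardHeatKernel ν T x₀ p.1)) p.2 * φ
      p =
      ν * ∫ p : ℝ × (EuclideanSpace ℝ (Fin 3)), (Δ (backwardHeatKernel ν T x₀ p.1)) p.2 * φ p := by
    rw [← MeasureTheory.integral_const_mul]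
    exact integral_congr_ae (Eventually.of_forall fun p => mul_assoc _ _ _)
  rw [integral_sub i12 i3, integral_add iA iB, MeasureTheory.integral_const_mul, h1, h1', h2, h3]
  ring

/-- **Registered sub-goal `stub_weakCorrector_gamma`** (closed form of `weakCorrector_gamma_ibp`):
the backward heat kernel against test functions supported in `{t < T}`. -/
theorem stub_weakCorrector_gamma :
    ∀ (ν T : ℝ) (b : ℝ → EuclideanSpace ℝ (Fin 3) → EuclideanSpace ℝ (Fin 3)) (x₀ : EuclideanSpace ℝ (Fin 3)) (φ : ℝ × EuclideanSpace ℝ (Fin 3) → ℝ), 0 < ν → ContDiff ℝ 1 (uncurry b) → (∀ t, VectorCalculus.IsDivFree (b t)) → ContDiff ℝ ∞ φ → HasCompactSupport φ → tsupport φ ⊆ Iio T ×ˢ univ → ∫ p : ℝ × EuclideanSpace ℝ (Fin 3), backwardHeatKernel ν T x₀ p.1 p.2 * (deriv (fun s => φ (s, p.2)) p.1 + fderiv ℝ (fun y => φ (p.1, y)) p.2 (b p.1 p.2) - ν * (Δ (fun y => φ (p.1, y))) p.2) = -∫ p : ℝ × EuclideanSpace ℝ (Fin 3), fderiv ℝ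 (backwardHeatKernel ν T x₀ p.1) p.2 (b p.1 p.2) * φ p :=
  fun _ _ _ _ _ hν hb hdiv hφ hφc hφT => weakCorrector_gamma_ibp hν hb hdiv hφ hφc hφT

end Gamma

end Summit.NavierStokesRegularity.NavierStokesRegularity.Theorems.AdaptedKernelExists.NashEntropyLastBlock

end
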